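import Summits.NavierStokesRegularity.NavierStokesRegularity.Theses.TypeIQuarterGate
import Summits.NavierStokesRegularity.NavierStokesRegularity.Theorems.CertifiedBlowupCertifiedBlowupAxisymBlowupSwirlPersists
import HarnessLib

/-!
# `TypeIQuarterGate`: the axisymmetric stratum of the Type-I cruxes is EMPTY (calibration)

Known-case rung for the crux `QuarterLawTypeI` (stmt-NavierStokesRegularity-23726) and its Type-I
companions `FiniteScarsTypeI` (23842), `ScarEnvelopeTypeI` (23843), `UniformConcentrationCountTypeI`
(23970), `LorentzUpgradeTypeI` (24108 = the open stub `stub_lorentzUpgrade` of the registered line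
`lorentz-upgrade`).  All five share the hypotheses «maximal smooth solution on `[0,T)`, Leray–Hopf from
its rapidly decaying datum, sup-norm Type-I rate at `T`».  On AXISYMMETRIC data (swirl allowed) this
hypothesis set is VOID: Koch–Nadirashvili–Seregin–Šverák 2009 Thm 6.1–6.2 / Seregin–Šverák 2009
Thm 1.1 exclude axisymmetric Type-I blow-up, DISCHARGED in the tree
(`Literature.Analysis.FluidPDE.knss_no_axisymmetric_typeI_holds`, packaged for exactly this class as
`CertifiedBlowupAxisymBlowup.CompactAmplification.not_isTypeIBlowup_of_isMaximalSmoothSolution`: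
axisymmetry of the datum propagates by uniqueness, sub-slab boundedness from Tao's class).

Hence each of the five statements HOLDS on the axisymmetric class — `quarterLawTypeI_axisym`,
`lorentzUpgradeTypeI_axisym`, `finiteScarsTypeI_axisym`, `scarEnvelopeTypeI_axisym`,
`uniformConcentrationCountTypeI_axisym` (conclusions verbatim, one extra hypothesis
`IsAxisymmetric (u 0)`) — and `typeI_counterexample_not_axisym` records the contrapositive reading:
any counterexample to any of them has a NON-axisymmetric datum.  Calibration only: the general
(non-axisymmetric) statements remain OPEN; this is the analogue for route `TypeIQuarterGate` of
`GaldiLiouvilleGate`'s `parabolicGaldiLiouville_axisymmetric_noSwirl` and of shelf 1574's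
`EnstrophyQuarterLaw.AxisymCalibration`.

HONEST FRAMING: compositions of tree theorems; nothing about Navier–Stokes regularity in general is
claimed. [cite: KochNadirashviliSereginSverak2009, Thms 6.1–6.2] [cite: SereginSverak2009, Thm 1.1]
-/

-- the problem directory repeats the summit name (`NavierStokesRegularity/NavierStokesRegularity`)
set_option linter.dupNamespace false

noncomputable section

open Set MeasureTheory
open scoped ENNReal

namespace Summit.NavierStokesRegularity.NavierStokesRegularity.Theorems

namespace LorentzOfEnvelope

open Literature.Analysis.FluidPDE Literature.Analysis.FunctionSpaces
open Summit.NavierStokesRegularity.NavierStokesRegularity.Theses.TypeIQuarterGate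
open Summit.NavierStokesRegularity.NavierStokesRegularity.Theorems.CertifiedBlowupAxisymBlowup
  (CompactAmplification.not_isTypeIBlowup_of_isMaximalSmoothSolution)

/-- **`QuarterLawTypeI` on axisymmetric data** (vacuously: no axisymmetric Type-I blow-up).
[cite: KochNadirashviliSereginSverak2009, Thms 6.1–6.2] -/
theorem quarterLawTypeI_axisym :
    ∀ (ν T : ℝ), 0 < ν → 0 < T →
      ∀ (u : ℝ → EuclideanSpace ℝ (Fin 3) → EuclideanSpace ℝ (Fin 3))
        (p : ℝ → EuclideanSpace ℝ (Fin 3) → ℝ),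
        IsMaximalSmoothSolution ν 0 u p T → IsLerayHopfOn T ν 0 (u 0) u →
        HasRapidSpatialDecay (u 0) → IsAxisymmetric (u 0) → IsTypeIBlowup u T →
        ∃ K : ℝ, ∀ t ∈ Set.Ico 0 T,
          ∫⁻ x, ‖curl (u t) x‖ₑ ^ 2 ≤ ENNReal.ofReal (K / Real.sqrt (T - t)) :=
  fun _ν _T hν hT _u _p hmax hLH hdec hax hI =>
    absurd hI (CompactAmplification.not_isTypeIBlowup_of_isMaximalSmoothSolution hν hT hmax hLH hdec hax)

/-- **`LorentzUpgradeTypeI` (= stub `stub_lorentzUpgrade`) on axisymmetric data** (vacuously).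
[cite: KochNadirashviliSereginSverak2009, Thms 6.1–6.2] -/
theorem lorentzUpgradeTypeI_axisym :
    ∀ (ν T : ℝ), 0 < ν → 0 < T →
      ∀ (u : ℝ → EuclideanSpace ℝ (Fin 3) → EuclideanSpace ℝ (Fin 3))
        (p : ℝ → EuclideanSpace ℝ (Fin 3) → ℝ),
        IsMaximalSmoothSolution ν 0 u p T → IsLerayHopfOn T ν 0 (u 0) u →
        HasRapidSpatialDecay (u 0) → IsAxisymmetric (u 0) → IsTypeIBlowup u T →
        ∃ M' : ℝ, ∀ t ∈ Set.Ico 0 T, eWeakLpPow (u t) 3 volume ≤ ENNReal.ofReal M' :=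
  fun _ν _T hν hT _u _p hmax hLH hdec hax hI =>
    absurd hI (CompactAmplification.not_isTypeIBlowup_of_isMaximalSmoothSolution hν hT hmax hLH hdec hax)

/-- **`FiniteScarsTypeI` on axisymmetric data** (vacuously).
[cite: KochNadirashviliSereginSverak2009, Thms 6.1–6.2] -/
theorem finiteScarsTypeI_axisym :
    ∀ (ν T : ℝ), 0 < ν → 0 < T →
      ∀ (u : ℝ → EuclideanSpace ℝ (Fin 3) → EuclideanSpace ℝ (Fin 3))
        (p : ℝ → EuclideanSpace ℝ (Fin 3) → ℝ),
        IsMaximalSmoothSolution ν 0 u p T → IsLerayHopfOn T ν 0 (u 0) u →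
        HasRapidSpatialDecay (u 0) → IsAxisymmetric (u 0) → IsTypeIBlowup u T →
        ∃ σ : Finset (EuclideanSpace ℝ (Fin 3)), ∀ x ∉ σ, ∃ r : ℝ, 0 < r ∧ ∃ A : ℝ,
          ∀ t ∈ Set.Ico (T - r ^ 2) T, ∀ y ∈ Metric.ball x r, ‖u t y‖ ≤ A :=
  fun _ν _T hν hT _u _p hmax hLH hdec hax hI =>
    absurd hI (CompactAmplification.not_isTypeIBlowup_of_isMaximalSmoothSolution hν hT hmax hLH hdec hax)

/-- **`ScarEnvelopeTypeI` on axisymmetric data** (vacuously; the finite-scars hypothesis is not even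
needed). [cite: KochNadirashviliSereginSverak2009, Thms 6.1–6.2] -/
theorem scarEnvelopeTypeI_axisym :
    ∀ (ν T : ℝ), 0 < ν → 0 < T →
      ∀ (u : ℝ → EuclideanSpace ℝ (Fin 3) → EuclideanSpace ℝ (Fin 3))
        (p : ℝ → EuclideanSpace ℝ (Fin 3) → ℝ),
        IsMaximalSmoothSolution ν 0 u p T → IsLerayHopfOn T ν 0 (u 0) u →
        HasRapidSpatialDecay (u 0) → IsAxisymmetric (u 0) → IsTypeIBlowup u T →
        ∃ (σ : Finset (EuclideanSpace ℝ (Fin 3))) (C' : ℝ), ∀ t ∈ Set.Ico 0 T, ∀ x,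
          ‖u t x‖ ≤ C' + ∑ a ∈ σ, C' / (‖x - a‖ + Real.sqrt (T - t)) :=
  fun _ν _T hν hT _u _p hmax hLH hdec hax hI =>
    absurd hI (CompactAmplification.not_isTypeIBlowup_of_isMaximalSmoothSolution hν hT hmax hLH hdec hax)

/-- **`UniformConcentrationCountTypeI` on axisymmetric data** (vacuously).
[cite: KochNadirashviliSereginSverak2009, Thms 6.1–6.2] -/
theorem uniformConcentrationCountTypeI_axisym :
    ∀ (ν T : ℝ), 0 < ν → 0 < T →
      ∀ (u : ℝ → EuclideanSpace ℝ (Fin 3) → EuclideanSpace ℝ (Fin 3))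
        (p : ℝ → EuclideanSpace ℝ (Fin 3) → ℝ),
        IsMaximalSmoothSolution ν 0 u p T → IsLerayHopfOn T ν 0 (u 0) u →
        HasRapidSpatialDecay (u 0) → IsAxisymmetric (u 0) → IsTypeIBlowup u T →
        ∀ η : ℝ, 0 < η → ∃ N : ℕ, ∃ r₀ : ℝ, 0 < r₀ ∧ ∀ r : ℝ, 0 < r → r ≤ r₀ →
          ∀ σ : Finset (EuclideanSpace ℝ (Fin 3)),
            (∀ x ∈ σ, ∀ x' ∈ σ, x ≠ x' → 2 * r ≤ ‖x - x'‖) →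
            (∀ x ∈ σ, ENNReal.ofReal (η * r) ≤ ∫⁻ s in Set.Ioo (T - r ^ 2) T,
              ∫⁻ y in Metric.ball x r, ENNReal.ofReal (frobeniusNormSq (fderiv ℝ (u s) y))) →
            σ.card ≤ N :=
  fun _ν _T hν hT _u _p hmax hLH hdec hax hI =>
    absurd hI (CompactAmplification.not_isTypeIBlowup_of_isMaximalSmoothSolution hν hT hmax hLH hdec hax)

/-- **Any counterexample to a Type-I crux of the route is non-axisymmetric.** If for some maximal
smooth Leray–Hopf solution from a rapidly decaying datum with the Type-I rate ONE of the five
conclusions (quarter law, Lorentz bound, finite scars, scar envelope, uniform count) fails, then the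
datum is not axisymmetric. [cite: KochNadirashviliSereginSverak2009, Thms 6.1–6.2] -/
theorem typeI_counterexample_not_axisym {ν T : ℝ} (hν : 0 < ν) (hT : 0 < T)
    {u : ℝ → EuclideanSpace ℝ (Fin 3) → EuclideanSpace ℝ (Fin 3)}
    {p : ℝ → EuclideanSpace ℝ (Fin 3) → ℝ}
    (hmax : IsMaximalSmoothSolution ν 0 u p T) (hLH : IsLerayHopfOn T ν 0 (u 0) u)
    (hdec : HasRapidSpatialDecay (u 0)) (hI : IsTypeIBlowup u T) : ¬ IsAxisymmetric (u 0) :=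
  fun hax => CompactAmplification.not_isTypeIBlowup_of_isMaximalSmoothSolution hν hT hmax hLH hdec hax hI

end LorentzOfEnvelope

end Summit.NavierStokesRegularity.NavierStokesRegularity.Theorems
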